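import Literature.Algebra.Polynomial.HermiteVarianceCrossSequence
import Mathlib.Tactic
import HarnessLib

/-!
# Monomials in terms of Hermite polynomials: `xⁿ = H_n^{[−v]} (H^{[v]} (x))` (Rota–Kahaner–Odlyzko §10)

G.-C. Rota, D. Kahaner, A. Odlyzko, *Finite operator calculus* (1973), §10, pp. 721–723: the Hermite
polynomials of variance `v`, `H_n^{[v]} (x) = W_v⁻¹ xⁿ` (`W_v = e^{vD²/2}` the Weierstrass operator), form
a cross-sequence (p. 722 (***)), and

> Proposition 5 of Section 8 gives the umbral composition formula,
> (*) `H_n^{[v]} (H^{[μ]} (x)) = H_n^{[v+μ]} (x)`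

so that, with `H_n^{[0]} = xⁿ`, **`xⁿ = H_n^{[−v]} (H^{[v]} (x))`**: the expansion of the monomials in
Hermite polynomials is read off umbrally from the coefficients of `H_n^{[−v]}` ("whence we glean the
simpler expressions in terms of the classical Hermite polynomials … as we could also have done by umbral
methods", p. 722).

Typed here (all proved, on top of `HermiteVarianceCrossSequence`: `hermiteVar v n = H_n^{[v]}`,
`umbralComp_hermiteVar` = (*), `hermiteVar_eq_sum` = the coefficients, `hermiteVar_one` = Mathlib's
probabilists' `Polynomial.hermite`): `X_pow_eq_umbralComp_hermiteVar` (`xⁿ = H_n^{[−v]} (H^{[v]})`),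
`X_pow_eq_sum_hermiteVar` (`xⁿ = Σ_j [j even] (v/2)^{j/2}/(j/2)! (n)_j H_{n−j}^{[v]}`) and the classical
indexing `X_pow_eq_sum_hermiteVar'` (`xⁿ = Σ_{k ≤ n/2} (v/2)ᵏ (n)_{2k}/k! · H_{n−2k}^{[v]}`). The case `v = 1`
(Mathlib's `Polynomial.hermite`, `xⁿ = Σ_k C(n,2k) (2k−1)!! He_{n−2k}`) is ALREADY in the tree as
`Literature.Probability.Distributions.X_pow_eq_sum_hermite` (file `Probability/Distributions/HermiteLinearization`) (from Janson, Cor. 3.17) and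
is not restated here.

## References
* [RotaKahanerOdlyzko1973] G.-C. Rota, D. Kahaner, A. Odlyzko, *On the foundations of
  combinatorial theory VIII. Finite operator calculus*, J. Math. Anal. Appl. 42 (1973) 684–760,
  §10, pp. 721–723 (with §8 Proposition 5, p. 715).
-/

noncomputable section

open Polynomial Finset

namespace Literature.Algebra.Polynomial

variable (K : Type*) [Field K] [CharZero K]

/-- **`xⁿ = H_n^{[−v]} (H^{[v]} (x))`** — (*) with the orders `−v`, `v`: `H^{[−v]} ∘ H^{[v]} = H^{[0]} = (xⁿ)`. [cite: RotaKahanerOdlyzko1973, §10 (*), p. 722]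
[cite: RotaKahanerOdlyzko1973, §8 Proposition 5, p. 715] -/
theorem X_pow_eq_umbralComp_hermiteVar (v : K) (n : ℕ) :
    (X : K[X]) ^ n = umbralComp (hermiteVar (-v)) (hermiteVar v) n := by
  rw [umbralComp_hermiteVar, neg_add_cancel, hermiteVar_zero_left]

/-- **The monomials in terms of the Hermite polynomials of variance `v`**:
`xⁿ = Σ_{j=0}^{n} [j even] (v/2)^{j/2}/(j/2)! · (n)_j · H_{n−j}^{[v]} (x)` (the coefficients of `H_n^{[−v]}`
applied umbrally to `H^{[v]}`). [cite: RotaKahanerOdlyzko1973, §10, p. 722] -/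
theorem X_pow_eq_sum_hermiteVar (v : K) (n : ℕ) :
    (X : K[X]) ^ n = ∑ j ∈ range (n + 1),
      ((if Even j then (v / 2) ^ (j / 2) / ((j / 2).factorial : K) else 0) * (n.descFactorial j : K)) •
        hermiteVar v (n - j) := by
  rw [X_pow_eq_umbralComp_hermiteVar K v n, umbralComp_apply, hermiteVar_eq_sum, map_sum]
  refine sum_congr rfl fun j _ => ?_
  rw [map_smul, umbral_X_pow, neg_div, neg_neg]

/-- The same in the classical indexing over `k = j/2`:
`xⁿ = Σ_{k=0}^{⌊n/2⌋} (v/2)ᵏ (n)_{2k}/k! · H_{n−2k}^{[v]} (x)`. [cite: RotaKahanerOdlyzko1973, §10, p. 722] -/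
theorem X_pow_eq_sum_hermiteVar' (v : K) (n : ℕ) :
    (X : K[X]) ^ n = ∑ k ∈ range (n / 2 + 1),
      ((v / 2) ^ k / (k.factorial : K) * (n.descFactorial (2 * k) : K)) • hermiteVar v (n - 2 * k) := by
  rw [X_pow_eq_sum_hermiteVar K v n]
  -- drop the odd `j` and substitute `j = 2k`
  rw [← sum_filter_add_sum_filter_not (range (n + 1)) Even]
  have hodd : ∑ j ∈ (range (n + 1)).filter (fun j => ¬Even j),
      ((if Even j then (v / 2) ^ (j / 2) / ((j / 2).factorial : K) else 0) * (n.descFactorial j : K)) •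
        hermiteVar v (n - j) = 0 :=
    sum_eq_zero fun j hj => by rw [if_neg (mem_filter.1 hj).2, zero_mul, zero_smul]
  rw [hodd, add_zero]
  refine sum_nbij' (fun j => j / 2) (fun k => 2 * k) (fun j hj => ?_) (fun k hk => ?_) (fun j hj => ?_)
    (fun k hk => ?_) (fun j hj => ?_)
  · have h := mem_range.1 (mem_filter.1 hj).1
    exact mem_range.2 (by omega)
  · have h := mem_range.1 hk
    exact mem_filter.2 ⟨mem_range.2 (by omega), even_two_mul k⟩
  · obtain ⟨m, hm⟩ := (mem_filter.1 hj).2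
    omega
  · omega
  · obtain ⟨hjr, ⟨m, hm⟩⟩ := mem_filter.1 hj
    subst hm
    rw [if_pos ⟨m, rfl⟩, ← two_mul, Nat.mul_div_cancel_left m two_pos]

end Literature.Algebra.Polynomial
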